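import Literature.Analysis.FluidPDE.KochTataruPairing
import Literature.Analysis.FunctionSpaces.SmoothParametricIntegral
import Literature.Analysis.UnboundedOperators.HeatKernelBoundedData
import HarnessLib

/-!
# The time-integrated heat kernel `∫_ε^R G_s ds` and its second derivatives (Riesz kernels)

Analysis/FluidPDE support file for the discharge of Stein's `L^p` bound for the Hessian
(`stein1970_hessian_Lp_bound E`, `FluidPDE/HessianLaplacianLp`) in **general dimension**
(`FluidPDE/HessianLaplacianLpGeneralProofs`). The Riesz-transform identity `∂ₐ∂_b = -RₐR_bΔ`
(Stein 1970, Ch. III §1.3) is realised through the heat semigroup,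
`-Δ⁻¹ = ∫₀^∞ e^{sΔ} ds`, truncated in time: for `ε = e^α < R = e^β` let

  `P(z) = ∫_ε^R G_s(z) ds = ∫_α^β e^σ G_{e^σ}(z) dσ`   (`heatPot α β`, log-time form),

`G_s` the Gauss–Weierstrass kernel (`UnboundedOperators.heatKernel`). Everything is PROVED:

* `heatPot` is smooth and its spatial derivatives are the time integrals of the derivatives of
  the heat kernel (`fderiv_heatPot_apply`, `fderiv_fderiv_heatPot_apply` with the Gaussian
  Hessian `heatKernelD2` of `KochTataruPairing`, `fderiv_heatPotD2_apply` with its gradient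
  `oseenIntegrand`): differentiation under the integral sign for smooth integrands on a compact
  interval (`FunctionSpaces/SmoothParametricIntegral`), the time being written `s = e^σ` so that
  the integrand is smooth on all of `ℝ × E`;
* **`ΔP = G_R - G_ε`** (`laplacian_heatPot`): the heat equation `ΔG_s = ∂ₛG_s` integrated in time;
* **Calderón–Zygmund size of the kernels, uniformly in `ε, R`**: with the parabolic Gaussian
  bounds `|D²G_s(z)| ≤ C(s + |z|²)^{-(n+2)/2}`, `|D³G_s(z)| ≤ C(s + |z|²)^{-(n+3)/2}`
  (`abs_heatKernelD2_le_parabolic`, `norm_oseenIntegrand_le_parabolic`, from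
  `exists_heatKernel_le_rpow`) and `∫_ε^R (s + r²)^{-q} ds ≤ r^{2-2q}/(q-1)`,
  `|∂ₐ∂_bP(z)| ≤ C‖a‖‖b‖|z|^{-n}` and `|∇∂ₐ∂_bP(z)| ≤ C‖a‖‖b‖|z|^{-n-1}` for `z ≠ 0`
  (`abs_heatPotD2_le`, `norm_fderiv_heatPotD2_le`) — the hypotheses `|K| ≤ B|x|⁻ⁿ`,
  `|∇K| ≤ B|x|^{-n-1}` of Stein 1970, Ch. II §2.2 (2), §3.2 Theorem 2;
* `P, ∇P ∈ L¹` (qualitatively, for fixed `ε, R`: `lintegral_enorm_heatPot_lt_top`,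
  `lintegral_enorm_fderiv_heatPot_lt_top`).

## References

* E. M. Stein, *Singular integrals and differentiability properties of functions*, Princeton
  Math. Series 30 (1970): Ch. II §2.2 (2), §3.2 Theorem 2; Ch. III §1.3 (`∂²/∂xⱼ∂xₖ Δ⁻¹`),
  §2 (the heat semigroup). [`Stein1971`]
* L. C. Evans, *Partial Differential Equations*, 2nd ed. (2010), §2.3.1 (the fundamental
  solution of the heat equation). [`Evans2010`]
* H. Koch, D. Tataru, Adv. Math. 157 (2001), §2 (8) (Gaussian bounds against the parabolic
  distance). [`KochTataruAdvMath2001`]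
-/

noncomputable section

open MeasureTheory Set Filter Topology Function Metric InnerProductSpace intervalIntegral
open scoped ENNReal NNReal RealInnerProductSpace ContDiff Laplacian

namespace Literature.Analysis.FluidPDE

open UnboundedOperators (heatKernel)

variable {E : Type*} [NormedAddCommGroup E] [InnerProductSpace ℝ E] [FiniteDimensional ℝ E]

/-! ### Time integrals of smooth families: differentiation under the integral sign -/

section TimeIntegral

/-- The spatial directional derivative of a family `H : ℝ × E → ℝ` along `v`, as a new family:
`(σ, z) ↦ D_z H(σ, ·)(z) v`. [folklore] -/
def dirFamily (H : ℝ × E → ℝ) (v : E) : ℝ × E → ℝ := fun q => fderiv ℝ (fun w => H (q.1, w)) q.2 v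

omit [FiniteDimensional ℝ E] in
/-- The spatial derivative of the family is the full derivative applied to `(0, v)`. [folklore] -/
theorem dirFamily_eq {H : ℝ × E → ℝ} {n : WithTop ℕ∞} (hH : ContDiff ℝ n H) (hn : n ≠ 0)
    (v : E) (q : ℝ × E) : dirFamily H v q = fderiv ℝ H q ((0 : ℝ), v) := by
  rw [dirFamily, (FunctionSpaces.hasFDerivAt_comp_prodMk hH hn q.1 q.2).fderiv]
  simp

omit [FiniteDimensional ℝ E] in
/-- Spatial derivatives of a smooth family form a smooth family. [folklore] -/
theorem contDiff_dirFamily {H : ℝ × E → ℝ} (hH : ContDiff ℝ ∞ H) (v : E) :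
    ContDiff ℝ ∞ (dirFamily H v) := by
  have h : dirFamily H v = fun q => fderiv ℝ H q ((0 : ℝ), v) :=
    funext fun q => dirFamily_eq hH (by simp) v q
  rw [h]
  exact (hH.fderiv_right (m := ∞) (by exact_mod_cast le_top)).clm_apply contDiff_const

/-- **Differentiation under the time integral**: for a smooth family `H`,
`D(∫_α^β H(σ, ·) dσ)(z) v = ∫_α^β D_zH(σ, ·)(z) v dσ`. [folklore] -/
theorem fderiv_timeIntegral_apply {H : ℝ × E → ℝ} (hH : ContDiff ℝ ∞ H) (α β : ℝ) (z v : E) :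
    fderiv ℝ (fun z => ∫ σ in α..β, H (σ, z)) z v = ∫ σ in α..β, dirFamily H v (σ, z) := by
  rw [FunctionSpaces.fderiv_parametric_intervalIntegral_apply hH (by simp) α β z v]
  exact intervalIntegral.integral_congr fun σ _ => (dirFamily_eq hH (by simp) v (σ, z)).symm

/-- The time integral of a smooth family is smooth. [folklore] -/
theorem contDiff_timeIntegral {H : ℝ × E → ℝ} (hH : ContDiff ℝ ∞ H) (α β : ℝ) :
    ContDiff ℝ ∞ fun z => ∫ σ in α..β, H (σ, z) :=
  FunctionSpaces.contDiff_parametric_intervalIntegral hH α β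

end TimeIntegral

/-! ### The heat kernel in logarithmic time and the potential `P = ∫_ε^R G_s ds` -/

section Potential

/-- The heat kernel in logarithmic time with the Jacobian of `s = e^σ`:
`logHeat (σ, z) = e^σ G_{e^σ}(z)`, a smooth function on all of `ℝ × E`. [folklore] -/
def logHeat (q : ℝ × E) : ℝ := Real.exp q.1 * heatKernel (Real.exp q.1) q.2

omit [FiniteDimensional ℝ E] in
/-- `logHeat` is smooth (the heat kernel is jointly smooth on `(0, ∞) × E`,
`UnboundedOperators.contDiffOn_uncurry_heatKernel`). [folklore] -/
theorem contDiff_logHeat : ContDiff ℝ ∞ (logHeat (E := E)) := by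
  have hA : ContDiff ℝ ∞ fun q : ℝ × E => ((Real.exp q.1, q.2) : ℝ × E) :=
    (Real.contDiff_exp.comp contDiff_fst).prodMk contDiff_snd
  have hmaps : ∀ q : ℝ × E, ((Real.exp q.1, q.2) : ℝ × E) ∈ Ioi (0 : ℝ) ×ˢ (univ : Set E) :=
    fun q => ⟨Real.exp_pos _, mem_univ _⟩
  have hG : ContDiff ℝ ∞ fun q : ℝ × E => heatKernel (Real.exp q.1) q.2 :=
    (UnboundedOperators.contDiffOn_uncurry_heatKernel (E := E) (m := ∞)).comp_contDiff hA hmaps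
  exact (Real.contDiff_exp.comp contDiff_fst).mul hG

/-- **The time-integrated heat kernel** `P(z) = ∫_α^β e^σ G_{e^σ}(z) dσ = ∫_{e^α}^{e^β} G_s(z) ds`
(Stein 1970, Ch. III §2: `-Δ⁻¹ = ∫₀^∞ e^{sΔ} ds`, truncated to `[ε, R] = [e^α, e^β]`).
[cite: Stein1971, Ch. III §2] -/
def heatPot (α β : ℝ) (z : E) : ℝ := ∫ σ in α..β, logHeat (σ, z)

/-- The second spatial derivatives of the potential, `∂ₐ∂_bP(z) = ∫_α^β e^σ D²G_{e^σ}(z)[a, b] dσ`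
(see `fderiv_fderiv_heatPot_apply`). [folklore] -/
def heatPotD2 (α β : ℝ) (a b z : E) : ℝ := ∫ σ in α..β, Real.exp σ * heatKernelD2 (Real.exp σ) a b z

/-- `P` is smooth. [folklore] -/
theorem contDiff_heatPot (α β : ℝ) : ContDiff ℝ ∞ (heatPot (E := E) α β) :=
  contDiff_timeIntegral contDiff_logHeat α β

omit [FiniteDimensional ℝ E] in
/-- The first spatial derivative family of `logHeat`: `e^σ D G_{e^σ}(z) b`. [folklore] -/
theorem dirFamily_logHeat (b : E) :
    dirFamily (logHeat (E := E)) b = fun q => Real.exp q.1 * fderiv ℝ (heatKernel (Real.exp q.1)) q.2 b := by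
  funext q
  simp only [dirFamily, logHeat]
  rw [fderiv_const_mul ((contDiff_heatKernel_space (n := 1) (Real.exp q.1)).differentiable one_ne_zero q.2)]
  rfl

omit [FiniteDimensional ℝ E] in
/-- The second spatial derivative family: `e^σ D²G_{e^σ}(z)[a, b]`. [folklore] -/
theorem dirFamily_dirFamily_logHeat (a b : E) :
    dirFamily (dirFamily (logHeat (E := E)) b) a =
      fun q => Real.exp q.1 * heatKernelD2 (Real.exp q.1) a b q.2 := by
  funext q
  rw [dirFamily_logHeat]
  simp only [dirFamily]
  rw [fderiv_const_mul ((contDiff_fderiv_heatKernel_apply (n := 1) (Real.exp q.1) b).differentiable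
    one_ne_zero q.2)]
  simp only [FunLike.coe_smul, Pi.smul_apply, smul_eq_mul]
  rw [fderiv_fderiv_heatKernel_apply_eq_heatKernelD2]

omit [FiniteDimensional ℝ E] in
/-- The third spatial derivative family: `e^σ ⟪Θ_{e^σ}(z)[a, b], w⟫`. [folklore] -/
theorem dirFamily_dirFamily_dirFamily_logHeat (a b w : E) :
    dirFamily (dirFamily (dirFamily (logHeat (E := E)) b) a) w =
      fun q => Real.exp q.1 * ⟪oseenIntegrand (Real.exp q.1) q.2 a b, w⟫ := by
  funext q
  rw [dirFamily_dirFamily_logHeat]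
  simp only [dirFamily]
  rw [fderiv_const_mul ((contDiff_heatKernelD2 (n := 1) (Real.exp q.1) a b).differentiable one_ne_zero
    q.2)]
  simp only [FunLike.coe_smul, Pi.smul_apply, smul_eq_mul]
  rw [fderiv_heatKernelD2_apply]

/-- **First derivatives of `P`**: `DP(z) b = ∫_α^β e^σ DG_{e^σ}(z) b dσ`. [folklore] -/
theorem fderiv_heatPot_apply (α β : ℝ) (z b : E) :
    fderiv ℝ (heatPot α β) z b = ∫ σ in α..β, Real.exp σ * fderiv ℝ (heatKernel (Real.exp σ)) z b := by
  unfold heatPot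
  rw [fderiv_timeIntegral_apply contDiff_logHeat, dirFamily_logHeat]

/-- The first derivative of `P` along `b`, as a time integral of a smooth family. [folklore] -/
theorem fderiv_heatPot_apply_eq_timeIntegral (α β : ℝ) (b : E) :
    (fun z => fderiv ℝ (heatPot (E := E) α β) z b) = fun z => ∫ σ in α..β, dirFamily logHeat b (σ, z) := by
  funext z
  unfold heatPot
  rw [fderiv_timeIntegral_apply contDiff_logHeat]

/-- **Second derivatives of `P`**: `∂ₐ∂_bP = heatPotD2 α β a b`. [folklore] -/
theorem fderiv_fderiv_heatPot_apply (α β : ℝ) (a b z : E) :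
    fderiv ℝ (fun w => fderiv ℝ (heatPot α β) w b) z a = heatPotD2 α β a b z := by
  rw [fderiv_heatPot_apply_eq_timeIntegral,
    fderiv_timeIntegral_apply (contDiff_dirFamily contDiff_logHeat b), dirFamily_dirFamily_logHeat]
  rfl

omit [FiniteDimensional ℝ E] in
/-- `heatPotD2` as a time integral of a smooth family. [folklore] -/
theorem heatPotD2_eq_timeIntegral (α β : ℝ) (a b : E) :
    heatPotD2 (E := E) α β a b = fun z => ∫ σ in α..β, dirFamily (dirFamily logHeat b) a (σ, z) := by
  funext z
  rw [dirFamily_dirFamily_logHeat]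
  rfl

/-- `heatPotD2 α β a b` is smooth. [folklore] -/
theorem contDiff_heatPotD2 (α β : ℝ) (a b : E) : ContDiff ℝ ∞ (heatPotD2 (E := E) α β a b) := by
  rw [heatPotD2_eq_timeIntegral]
  exact contDiff_timeIntegral (contDiff_dirFamily (contDiff_dirFamily contDiff_logHeat b) a) α β

/-- **Third derivatives of `P`**: `D(∂ₐ∂_bP)(z) w = ∫_α^β e^σ ⟪Θ_{e^σ}(z)[a, b], w⟫ dσ`. [folklore] -/
theorem fderiv_heatPotD2_apply (α β : ℝ) (a b z w : E) :
    fderiv ℝ (heatPotD2 α β a b) z w =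
      ∫ σ in α..β, Real.exp σ * ⟪oseenIntegrand (Real.exp σ) z a b, w⟫ := by
  rw [heatPotD2_eq_timeIntegral,
    fderiv_timeIntegral_apply (contDiff_dirFamily (contDiff_dirFamily contDiff_logHeat b) a),
    dirFamily_dirFamily_dirFamily_logHeat]

end Potential

/-! ### The heat equation integrated in time: `ΔP = G_R - G_ε` -/

section LaplacianIdentity

omit [FiniteDimensional ℝ E] in
/-- The trace of the Gaussian Hessian: `Σᵢ D²G_s(z)[bᵢ, bᵢ] = (‖z‖²/(4s²) - n/(2s)) G_s(z)` for an
orthonormal basis `b` of the `n`-dimensional space (Evans, *PDE*, §2.3.1: `ΔΦ = ∂ₜΦ`). [folklore] -/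
theorem sum_heatKernelD2_self {ι : Type*} [Fintype ι] (b : OrthonormalBasis ι ℝ E) (s : ℝ) (z : E) :
    ∑ i, heatKernelD2 s (b i) (b i) z =
      (‖z‖ ^ 2 / (4 * s ^ 2) - (Fintype.card ι : ℝ) / (2 * s)) * heatKernel s z := by
  have h1 : ∀ i, ⟪b i, b i⟫ = (1 : ℝ) := fun i => by
    rw [real_inner_self_eq_norm_sq, b.orthonormal.1 i, one_pow]
  have h2 : ∑ i, ⟪z, b i⟫ * ⟪z, b i⟫ = ‖z‖ ^ 2 := by
    rw [← real_inner_self_eq_norm_sq, ← b.sum_inner_mul_inner z z]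
    exact Finset.sum_congr rfl fun i _ => by rw [real_inner_comm (b i) z]
  simp only [heatKernelD2, h1]
  rw [← Finset.mul_sum, Finset.sum_sub_distrib, ← Finset.sum_div, h2, Finset.sum_const,
    Finset.card_univ, nsmul_eq_mul, mul_one_div]
  ring

omit [FiniteDimensional ℝ E] in
/-- The log-time integrand `σ ↦ e^σ D²G_{e^σ}(z)[a, b]` is continuous. [folklore] -/
theorem continuous_exp_mul_heatKernelD2 (a b z : E) :
    Continuous fun σ : ℝ => Real.exp σ * heatKernelD2 (Real.exp σ) a b z := by
  have h := (contDiff_dirFamily (contDiff_dirFamily (contDiff_logHeat (E := E)) b) a).continuous.comp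
    (continuous_id.prodMk continuous_const : Continuous fun σ : ℝ => (σ, z))
  rw [dirFamily_dirFamily_logHeat] at h
  exact h

omit [FiniteDimensional ℝ E] in
/-- The log-time integrand `σ ↦ e^σ ⟪Θ_{e^σ}(z)[a, b], w⟫` is continuous. [folklore] -/
theorem continuous_exp_mul_inner_oseenIntegrand (a b z w : E) :
    Continuous fun σ : ℝ => Real.exp σ * ⟪oseenIntegrand (Real.exp σ) z a b, w⟫ := by
  have h := (contDiff_dirFamily (contDiff_dirFamily (contDiff_dirFamily
    (contDiff_logHeat (E := E)) b) a) w).continuous.comp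
    (continuous_id.prodMk continuous_const : Continuous fun σ : ℝ => (σ, z))
  rw [dirFamily_dirFamily_dirFamily_logHeat] at h
  exact h

omit [FiniteDimensional ℝ E] in
/-- **The time derivative in logarithmic time**: `d/dσ G_{e^σ}(z) = e^σ (ΔG_s)(z)|_{s = e^σ}`
(heat equation for the kernel, `hasDerivAt_heatKernel_time`, and the chain rule). [folklore] -/
theorem hasDerivAt_heatKernel_exp (σ : ℝ) (z : E) :
    HasDerivAt (fun σ : ℝ => heatKernel (Real.exp σ) z)
      (Real.exp σ * ((‖z‖ ^ 2 / (4 * Real.exp σ ^ 2) -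
        (Module.finrank ℝ E : ℝ) / (2 * Real.exp σ)) * heatKernel (Real.exp σ) z)) σ := by
  have h := (UnboundedOperators.hasDerivAt_heatKernel_time (Real.exp_pos σ) z).comp σ
    (Real.hasDerivAt_exp σ)
  rw [mul_comm] at h
  exact h

/-- **`ΔP = G_R - G_ε`** for the time-integrated heat kernel `P = ∫_ε^R G_s ds`
(`ε = e^α ≤ R = e^β`): the Laplacian passes under the time integral, `ΔG_s = ∂ₛG_s`, and the
fundamental theorem of calculus (Stein 1970, Ch. III §2; Evans, §2.3.1). [cite: Stein1971, Ch. III §2] -/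
theorem laplacian_heatPot (α β : ℝ) (z : E) :
    (Δ (heatPot (E := E) α β)) z = heatKernel (Real.exp β) z - heatKernel (Real.exp α) z := by
  set b := stdOrthonormalBasis ℝ E with hb
  have h2 : ContDiff ℝ 2 (heatPot (E := E) α β) := (contDiff_heatPot α β).of_le (by decide)
  rw [laplacian_eq_sum_fderiv_fderiv b h2 z]
  simp_rw [fderiv_fderiv_heatPot_apply, heatPotD2]
  rw [← intervalIntegral.integral_finsetSum (fun i _ =>
    ((continuous_exp_mul_heatKernelD2 (b i) (b i) z).intervalIntegrable _ _))]
  have hsum : ∀ σ : ℝ, ∑ i, Real.exp σ * heatKernelD2 (Real.exp σ) (b i) (b i) z =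
      Real.exp σ * ((‖z‖ ^ 2 / (4 * Real.exp σ ^ 2) -
        (Module.finrank ℝ E : ℝ) / (2 * Real.exp σ)) * heatKernel (Real.exp σ) z) := fun σ => by
    rw [← Finset.mul_sum, sum_heatKernelD2_self b, Fintype.card_fin]
  simp_rw [hsum]
  refine intervalIntegral.integral_eq_sub_of_hasDerivAt (fun σ _ => hasDerivAt_heatKernel_exp σ z) ?_
  refine Continuous.intervalIntegrable ?_ _ _
  have hc : Continuous fun σ : ℝ => ∑ i, Real.exp σ * heatKernelD2 (Real.exp σ) (b i) (b i) z :=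
    continuous_finsetSum _ fun i _ => continuous_exp_mul_heatKernelD2 (b i) (b i) z
  simp_rw [hsum] at hc
  exact hc

end LaplacianIdentity

/-! ### Parabolic Gaussian bounds for `D²G_s` and `D³G_s` -/

section GaussianBounds

omit [FiniteDimensional ℝ E] in
/-- **Gaussian bound for the Hessian of the heat kernel against the parabolic distance**: there
is `C = C(E)` with `|D²G_s(z)[a, b]| ≤ C ‖a‖ ‖b‖ (s + ‖z‖²)^{-(n+2)/2}` for `s > 0`
(Koch–Tataru 2001, §2 (8)). [cite: KochTataruAdvMath2001, §2 (8)] -/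
theorem abs_heatKernelD2_le_parabolic :
    ∃ C : ℝ, 0 < C ∧ ∀ {s : ℝ}, 0 < s → ∀ a b z : E,
      |heatKernelD2 s a b z| ≤
        C * ‖a‖ * ‖b‖ * (s + ‖z‖ ^ 2) ^ (-(((Module.finrank ℝ E : ℝ) + 2) / 2)) := by
  set d : ℝ := (Module.finrank ℝ E : ℝ) with hd
  obtain ⟨C₁, hC₁, h₁⟩ := exists_heatKernel_le_rpow (E := E) (d / 2 + 1)
  obtain ⟨C₂, hC₂, h₂⟩ := exists_heatKernel_le_rpow (E := E) (d / 2 + 2)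
  refine ⟨C₁ / 2 + C₂ / 4, by positivity, fun {s} hs a b z => ?_⟩
  have hsz : 0 < s + ‖z‖ ^ 2 := by positivity
  have hG1 := h₁ hs z
  have hG2 := h₂ hs z
  rw [show d / 2 + 1 - (Module.finrank ℝ E : ℝ) / 2 = 1 by rw [hd]; ring, Real.rpow_one] at hG1
  rw [show d / 2 + 2 - (Module.finrank ℝ E : ℝ) / 2 = 2 by rw [hd]; ring] at hG2
  have hGpos := (UnboundedOperators.heatKernel_pos hs z).le
  have hab : |⟪a, b⟫| ≤ ‖a‖ * ‖b‖ := abs_real_inner_le_norm a b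
  have hza : |⟪z, a⟫| ≤ ‖z‖ * ‖a‖ := abs_real_inner_le_norm z a
  have hzb : |⟪z, b⟫| ≤ ‖z‖ * ‖b‖ := abs_real_inner_le_norm z b
  have hT1 : heatKernel s z * (|⟪a, b⟫| / (2 * s)) ≤
      C₁ / 2 * ‖a‖ * ‖b‖ * (s + ‖z‖ ^ 2) ^ (-(d / 2 + 1)) := by
    calc heatKernel s z * (|⟪a, b⟫| / (2 * s))
        ≤ (C₁ * s * (s + ‖z‖ ^ 2) ^ (-(d / 2 + 1))) * ((‖a‖ * ‖b‖) / (2 * s)) := by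
          gcongr
      _ = C₁ / 2 * ‖a‖ * ‖b‖ * (s + ‖z‖ ^ 2) ^ (-(d / 2 + 1)) := by
          field_simp
  have hT2 : heatKernel s z * (|⟪z, a⟫| * |⟪z, b⟫| / (4 * s ^ 2)) ≤
      C₂ / 4 * ‖a‖ * ‖b‖ * (s + ‖z‖ ^ 2) ^ (-(d / 2 + 1)) := by
    have hz2 : ‖z‖ ^ 2 ≤ s + ‖z‖ ^ 2 := by linarith
    calc heatKernel s z * (|⟪z, a⟫| * |⟪z, b⟫| / (4 * s ^ 2))
        ≤ (C₂ * s ^ (2 : ℝ) * (s + ‖z‖ ^ 2) ^ (-(d / 2 + 2))) *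
            ((‖z‖ * ‖a‖) * (‖z‖ * ‖b‖) / (4 * s ^ 2)) := by
          gcongr
      _ = C₂ / 4 * ‖a‖ * ‖b‖ * (‖z‖ ^ 2 * (s + ‖z‖ ^ 2) ^ (-(d / 2 + 2))) := by
          rw [Real.rpow_two]; field_simp
      _ ≤ C₂ / 4 * ‖a‖ * ‖b‖ * ((s + ‖z‖ ^ 2) * (s + ‖z‖ ^ 2) ^ (-(d / 2 + 2))) := by
          gcongr
      _ = C₂ / 4 * ‖a‖ * ‖b‖ * (s + ‖z‖ ^ 2) ^ (-(d / 2 + 1)) := by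
          rw [show -(d / 2 + 1) = 1 + (-(d / 2 + 2)) by ring, Real.rpow_add hsz, Real.rpow_one]
  have hexp : -(d / 2 + 1) = -((d + 2) / 2) := by ring
  rw [hexp] at hT1 hT2
  rw [heatKernelD2, abs_mul, abs_of_nonneg hGpos]
  calc heatKernel s z * |⟪z, a⟫ * ⟪z, b⟫ / (4 * s ^ 2) - ⟪a, b⟫ / (2 * s)|
      ≤ heatKernel s z * (|⟪z, a⟫| * |⟪z, b⟫| / (4 * s ^ 2) + |⟪a, b⟫| / (2 * s)) := by
        refine mul_le_mul_of_nonneg_left ((abs_sub _ _).trans (le_of_eq ?_)) hGpos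
        rw [abs_div, abs_div, abs_mul, abs_of_pos (by positivity : (0 : ℝ) < 4 * s ^ 2),
          abs_of_pos (by positivity : (0 : ℝ) < 2 * s)]
    _ = heatKernel s z * (|⟪z, a⟫| * |⟪z, b⟫| / (4 * s ^ 2)) +
          heatKernel s z * (|⟪a, b⟫| / (2 * s)) := by ring
    _ ≤ C₂ / 4 * ‖a‖ * ‖b‖ * (s + ‖z‖ ^ 2) ^ (-((d + 2) / 2)) +
          C₁ / 2 * ‖a‖ * ‖b‖ * (s + ‖z‖ ^ 2) ^ (-((d + 2) / 2)) := add_le_add hT2 hT1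
    _ = (C₁ / 2 + C₂ / 4) * ‖a‖ * ‖b‖ * (s + ‖z‖ ^ 2) ^ (-((d + 2) / 2)) := by ring

omit [FiniteDimensional ℝ E] in
/-- **Gaussian bound for the third derivatives of the heat kernel against the parabolic
distance**: there is `C = C(E)` with `‖Θ_s(z)[a, b]‖ ≤ C ‖a‖ ‖b‖ (s + ‖z‖²)^{-(n+3)/2}` for
`s > 0`, `Θ_s = ∇D²G_s` (`oseenIntegrand`; Koch–Tataru 2001, §2 (8)). [cite: KochTataruAdvMath2001, §2 (8)] -/
theorem norm_oseenIntegrand_le_parabolic :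
    ∃ C : ℝ, 0 < C ∧ ∀ {s : ℝ}, 0 < s → ∀ z a b : E,
      ‖oseenIntegrand s z a b‖ ≤
        C * ‖a‖ * ‖b‖ * (s + ‖z‖ ^ 2) ^ (-(((Module.finrank ℝ E : ℝ) + 3) / 2)) := by
  set d : ℝ := (Module.finrank ℝ E : ℝ) with hd
  obtain ⟨C₂, hC₂, h₂⟩ := exists_heatKernel_le_rpow (E := E) (d / 2 + 2)
  obtain ⟨C₃, hC₃, h₃⟩ := exists_heatKernel_le_rpow (E := E) (d / 2 + 3)
  refine ⟨3 * C₂ / 4 + C₃ / 8, by positivity, fun {s} hs z a b => ?_⟩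
  set ρ : ℝ := s + ‖z‖ ^ 2 with hρ
  have hρ0 : 0 < ρ := by positivity
  have hzρ : ‖z‖ ≤ ρ ^ (1 / 2 : ℝ) := norm_le_add_sq_rpow_half hs.le z
  have hGpos : 0 < heatKernel s z := UnboundedOperators.heatKernel_pos hs z
  have hG2 := h₂ hs z
  have hG3 := h₃ hs z
  rw [show d / 2 + 2 - (Module.finrank ℝ E : ℝ) / 2 = 2 by rw [hd]; ring] at hG2
  rw [show d / 2 + 3 - (Module.finrank ℝ E : ℝ) / 2 = 3 by rw [hd]; ring] at hG3
  -- the two Gaussian moments against the parabolic distance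
  have hmA : heatKernel s z / (4 * s ^ 2) * ‖z‖ ≤ C₂ / 4 * ρ ^ (-((d + 3) / 2)) := by
    calc heatKernel s z / (4 * s ^ 2) * ‖z‖
        ≤ (C₂ * s ^ (2 : ℝ) * ρ ^ (-(d / 2 + 2))) / (4 * s ^ 2) * ρ ^ (1 / 2 : ℝ) := by gcongr
      _ = C₂ / 4 * (ρ ^ (1 / 2 : ℝ) * ρ ^ (-(d / 2 + 2))) := by
          rw [Real.rpow_two]; field_simp
      _ = C₂ / 4 * ρ ^ (-((d + 3) / 2)) := by
          rw [← Real.rpow_add hρ0]; congr 1; congr 1; ring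
  have hmB : heatKernel s z / (8 * s ^ 3) * ‖z‖ ^ 3 ≤ C₃ / 8 * ρ ^ (-((d + 3) / 2)) := by
    have hz3 : ‖z‖ ^ 3 ≤ (ρ ^ (1 / 2 : ℝ)) ^ 3 := by gcongr
    calc heatKernel s z / (8 * s ^ 3) * ‖z‖ ^ 3
        ≤ (C₃ * s ^ (3 : ℝ) * ρ ^ (-(d / 2 + 3))) / (8 * s ^ 3) * (ρ ^ (1 / 2 : ℝ)) ^ 3 := by gcongr
      _ = C₃ / 8 * ((ρ ^ (1 / 2 : ℝ)) ^ 3 * ρ ^ (-(d / 2 + 3))) := by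
          rw [show (3 : ℝ) = ((3 : ℕ) : ℝ) by norm_num, Real.rpow_natCast]; field_simp
      _ = C₃ / 8 * ρ ^ (-((d + 3) / 2)) := by
          rw [← Real.rpow_natCast, ← Real.rpow_mul hρ0.le, ← Real.rpow_add hρ0]
          congr 1; congr 1; push_cast; ring
  have habs : |heatKernel s z| = heatKernel s z := abs_of_pos hGpos
  have hs3 : |s| ^ 3 = s ^ 3 := by rw [abs_of_pos hs]
  calc ‖oseenIntegrand s z a b‖
      ≤ (3 * (|heatKernel s z| / (4 * s ^ 2)) * ‖z‖ +
          |heatKernel s z| / (8 * |s| ^ 3) * ‖z‖ ^ 3) * ‖a‖ * ‖b‖ := norm_oseenIntegrand_le s z a b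
    _ = (3 * (heatKernel s z / (4 * s ^ 2) * ‖z‖) + heatKernel s z / (8 * s ^ 3) * ‖z‖ ^ 3) *
          ‖a‖ * ‖b‖ := by rw [habs, hs3]; ring
    _ ≤ (3 * (C₂ / 4 * ρ ^ (-((d + 3) / 2))) + C₃ / 8 * ρ ^ (-((d + 3) / 2))) * ‖a‖ * ‖b‖ := by
        gcongr
    _ = (3 * C₂ / 4 + C₃ / 8) * ‖a‖ * ‖b‖ * ρ ^ (-((d + 3) / 2)) := by ring

end GaussianBounds

/-! ### Time integration against the parabolic distance; the Calderón–Zygmund size of `D²P`, `D³P` -/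

section KernelBounds

/-- **The time integral against the parabolic distance**: for `q > 1`, `c > 0` and all `α, β`,
`∫_α^β e^σ (e^σ + c)^{-q} dσ = ∫_{e^α}^{e^β} (s + c)^{-q} ds ≤ c^{1-q}/(q-1)` (explicit
antiderivative `-(s + c)^{1-q}/(q-1)`; for `β < α` the left side is `≤ 0`). [folklore] -/
theorem intervalIntegral_exp_mul_rpow_neg_le {q c : ℝ} (hq : 1 < q) (hc : 0 < c) (α β : ℝ) :
    ∫ σ in α..β, Real.exp σ * (Real.exp σ + c) ^ (-q) ≤ c ^ (1 - q) / (q - 1) := by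
  have hq1 : (1 - q) ≠ 0 := by linarith
  have hpos : ∀ σ : ℝ, 0 < Real.exp σ + c := fun σ => by positivity
  -- the antiderivative
  have hF : ∀ σ : ℝ, HasDerivAt (fun σ => (Real.exp σ + c) ^ (1 - q) / (1 - q))
      (Real.exp σ * (Real.exp σ + c) ^ (-q)) σ := by
    intro σ
    have h := (((Real.hasDerivAt_exp σ).add_const c).rpow_const (p := 1 - q)
      (Or.inl (hpos σ).ne')).div_const (1 - q)
    refine h.congr_deriv ?_
    rw [show (1 - q - 1) = -q by ring]
    field_simp
  have hcont : Continuous fun σ : ℝ => Real.exp σ * (Real.exp σ + c) ^ (-q) :=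
    Real.continuous_exp.mul ((Real.continuous_exp.add continuous_const).rpow_const
      fun σ => Or.inl (hpos σ).ne')
  rw [intervalIntegral.integral_eq_sub_of_hasDerivAt (fun σ _ => hF σ) (hcont.intervalIntegrable _ _)]
  -- `[(e^β + c)^{1-q} - (e^α + c)^{1-q}]/(1-q) ≤ (e^α + c)^{1-q}/(q-1) ≤ c^{1-q}/(q-1)`
  have hq' : 0 < q - 1 := by linarith
  have hA : (Real.exp α + c) ^ (1 - q) ≤ c ^ (1 - q) :=
    Real.rpow_le_rpow_of_nonpos hc (by linarith [Real.exp_pos α]) (by linarith)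
  have hB : 0 ≤ (Real.exp β + c) ^ (1 - q) := Real.rpow_nonneg (hpos β).le _
  have hq1' : (q - 1) ≠ 0 := hq'.ne'
  have hrw : (Real.exp β + c) ^ (1 - q) / (1 - q) - (Real.exp α + c) ^ (1 - q) / (1 - q) =
      ((Real.exp α + c) ^ (1 - q) - (Real.exp β + c) ^ (1 - q)) / (q - 1) := by
    field_simp
    ring
  rw [hrw, div_le_div_iff_of_pos_right hq']
  linarith

omit [InnerProductSpace ℝ E] [FiniteDimensional ℝ E] in
/-- `(‖z‖²)^{-(m/2)} = ‖z‖^{-m}`. [folklore] -/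
theorem norm_sq_rpow_neg_half (z : E) (m : ℝ) : (‖z‖ ^ 2) ^ (-(m / 2)) = ‖z‖ ^ (-m) := by
  rw [← Real.rpow_natCast, ← Real.rpow_mul (norm_nonneg z)]
  congr 1
  push_cast
  ring

omit [FiniteDimensional ℝ E] in
/-- **Size of the Riesz kernels `∂ₐ∂_bP`, uniformly in `ε, R`**: with the constant `C` of
`abs_heatKernelD2_le_parabolic` and `n = dim E ≥ 1`,
`|∂ₐ∂_bP(z)| ≤ (2C/n) ‖a‖ ‖b‖ ‖z‖⁻ⁿ` for `z ≠ 0`, `α ≤ β` (Stein 1970, Ch. II §2.2: `|K(x)| ≤ B|x|⁻ⁿ`).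
[cite: Stein1971, Ch. II §2.2] -/
theorem abs_heatPotD2_le (hn : 1 ≤ Module.finrank ℝ E) {C : ℝ} (hC : 0 < C)
    (hCb : ∀ {s : ℝ}, 0 < s → ∀ a b z : E, |heatKernelD2 s a b z| ≤
      C * ‖a‖ * ‖b‖ * (s + ‖z‖ ^ 2) ^ (-(((Module.finrank ℝ E : ℝ) + 2) / 2)))
    {α β : ℝ} (hαβ : α ≤ β) (a b : E) {z : E} (hz : z ≠ 0) :
    |heatPotD2 α β a b z| ≤
      (2 * C / Module.finrank ℝ E) * ‖a‖ * ‖b‖ * ‖z‖ ^ (-(Module.finrank ℝ E : ℝ)) := by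
  set n : ℝ := (Module.finrank ℝ E : ℝ) with hn_def
  have hn1 : (1 : ℝ) ≤ n := by rw [hn_def]; exact_mod_cast hn
  have hzpos : 0 < ‖z‖ := norm_pos_iff.2 hz
  have hc : 0 < ‖z‖ ^ 2 := by positivity
  set q : ℝ := (n + 2) / 2 with hq_def
  have hq : 1 < q := by rw [hq_def]; linarith
  have hcontD : Continuous fun σ : ℝ => Real.exp σ * heatKernelD2 (Real.exp σ) a b z :=
    continuous_exp_mul_heatKernelD2 a b z
  have hcontB : Continuous fun σ : ℝ => Real.exp σ * (Real.exp σ + ‖z‖ ^ 2) ^ (-q) :=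
    Real.continuous_exp.mul ((Real.continuous_exp.add continuous_const).rpow_const
      fun σ => Or.inl (by positivity : Real.exp σ + ‖z‖ ^ 2 ≠ 0))
  have hpt : ∀ σ : ℝ, |Real.exp σ * heatKernelD2 (Real.exp σ) a b z| ≤
      C * ‖a‖ * ‖b‖ * (Real.exp σ * (Real.exp σ + ‖z‖ ^ 2) ^ (-q)) := by
    intro σ
    rw [abs_mul, abs_of_pos (Real.exp_pos σ)]
    calc Real.exp σ * |heatKernelD2 (Real.exp σ) a b z|
        ≤ Real.exp σ * (C * ‖a‖ * ‖b‖ * (Real.exp σ + ‖z‖ ^ 2) ^ (-q)) :=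
          mul_le_mul_of_nonneg_left (hCb (Real.exp_pos σ) a b z) (Real.exp_pos σ).le
      _ = C * ‖a‖ * ‖b‖ * (Real.exp σ * (Real.exp σ + ‖z‖ ^ 2) ^ (-q)) := by ring
  calc |heatPotD2 α β a b z|
      ≤ ∫ σ in α..β, |Real.exp σ * heatKernelD2 (Real.exp σ) a b z| :=
        intervalIntegral.abs_integral_le_integral_abs hαβ
    _ ≤ ∫ σ in α..β, C * ‖a‖ * ‖b‖ * (Real.exp σ * (Real.exp σ + ‖z‖ ^ 2) ^ (-q)) :=
        intervalIntegral.integral_mono_on hαβ (hcontD.abs.intervalIntegrable _ _)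
          ((hcontB.const_mul _).intervalIntegrable _ _) fun σ _ => hpt σ
    _ = C * ‖a‖ * ‖b‖ * ∫ σ in α..β, Real.exp σ * (Real.exp σ + ‖z‖ ^ 2) ^ (-q) :=
        intervalIntegral.integral_const_mul _ _
    _ ≤ C * ‖a‖ * ‖b‖ * ((‖z‖ ^ 2) ^ (1 - q) / (q - 1)) :=
        mul_le_mul_of_nonneg_left (intervalIntegral_exp_mul_rpow_neg_le hq hc α β) (by positivity)
    _ = (2 * C / n) * ‖a‖ * ‖b‖ * ‖z‖ ^ (-n) := by
        rw [show 1 - q = -(n / 2) by rw [hq_def]; ring, norm_sq_rpow_neg_half,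
          show q - 1 = n / 2 by rw [hq_def]; ring]
        field_simp

/-- **Size of the gradients of the Riesz kernels, uniformly in `ε, R`**: with the constant `C` of
`norm_oseenIntegrand_le_parabolic`, `‖∇∂ₐ∂_bP(z)‖ ≤ (2C/(n+1)) ‖a‖ ‖b‖ ‖z‖^{-(n+1)}` for `z ≠ 0`,
`α ≤ β` (Stein 1970, Ch. II §2.2 (2): `|∇K(x)| ≤ B|x|^{-n-1}`). [cite: Stein1971, Ch. II §2.2 (2)] -/
theorem norm_fderiv_heatPotD2_le {C : ℝ} (hC : 0 < C)
    (hCb : ∀ {s : ℝ}, 0 < s → ∀ z a b : E, ‖oseenIntegrand s z a b‖ ≤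
      C * ‖a‖ * ‖b‖ * (s + ‖z‖ ^ 2) ^ (-(((Module.finrank ℝ E : ℝ) + 3) / 2)))
    {α β : ℝ} (hαβ : α ≤ β) (a b : E) {z : E} (hz : z ≠ 0) :
    ‖fderiv ℝ (heatPotD2 α β a b) z‖ ≤
      (2 * C / (Module.finrank ℝ E + 1)) * ‖a‖ * ‖b‖ * ‖z‖ ^ (-((Module.finrank ℝ E : ℝ) + 1)) := by
  set n : ℝ := (Module.finrank ℝ E : ℝ) with hn_def
  have hn0 : (0 : ℝ) ≤ n := Nat.cast_nonneg _
  have hzpos : 0 < ‖z‖ := norm_pos_iff.2 hz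
  have hc : 0 < ‖z‖ ^ 2 := by positivity
  set q : ℝ := (n + 3) / 2 with hq_def
  have hq : 1 < q := by rw [hq_def]; linarith
  have hK : 0 ≤ (2 * C / (n + 1)) * ‖a‖ * ‖b‖ * ‖z‖ ^ (-(n + 1)) := by positivity
  refine ContinuousLinearMap.opNorm_le_bound _ hK fun w => ?_
  rw [fderiv_heatPotD2_apply, Real.norm_eq_abs]
  have hcontD : Continuous fun σ : ℝ => Real.exp σ * ⟪oseenIntegrand (Real.exp σ) z a b, w⟫ :=
    continuous_exp_mul_inner_oseenIntegrand a b z w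
  have hcontB : Continuous fun σ : ℝ => Real.exp σ * (Real.exp σ + ‖z‖ ^ 2) ^ (-q) :=
    Real.continuous_exp.mul ((Real.continuous_exp.add continuous_const).rpow_const
      fun σ => Or.inl (by positivity : Real.exp σ + ‖z‖ ^ 2 ≠ 0))
  have hpt : ∀ σ : ℝ, |Real.exp σ * ⟪oseenIntegrand (Real.exp σ) z a b, w⟫| ≤
      C * ‖a‖ * ‖b‖ * ‖w‖ * (Real.exp σ * (Real.exp σ + ‖z‖ ^ 2) ^ (-q)) := by
    intro σ
    rw [abs_mul, abs_of_pos (Real.exp_pos σ)]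
    have h1 : |⟪oseenIntegrand (Real.exp σ) z a b, w⟫| ≤
        C * ‖a‖ * ‖b‖ * (Real.exp σ + ‖z‖ ^ 2) ^ (-q) * ‖w‖ :=
      (abs_real_inner_le_norm _ _).trans (mul_le_mul_of_nonneg_right
        (hCb (Real.exp_pos σ) z a b) (norm_nonneg w))
    calc Real.exp σ * |⟪oseenIntegrand (Real.exp σ) z a b, w⟫|
        ≤ Real.exp σ * (C * ‖a‖ * ‖b‖ * (Real.exp σ + ‖z‖ ^ 2) ^ (-q) * ‖w‖) :=
          mul_le_mul_of_nonneg_left h1 (Real.exp_pos σ).le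
      _ = C * ‖a‖ * ‖b‖ * ‖w‖ * (Real.exp σ * (Real.exp σ + ‖z‖ ^ 2) ^ (-q)) := by ring
  calc |∫ σ in α..β, Real.exp σ * ⟪oseenIntegrand (Real.exp σ) z a b, w⟫|
      ≤ ∫ σ in α..β, |Real.exp σ * ⟪oseenIntegrand (Real.exp σ) z a b, w⟫| :=
        intervalIntegral.abs_integral_le_integral_abs hαβ
    _ ≤ ∫ σ in α..β, C * ‖a‖ * ‖b‖ * ‖w‖ * (Real.exp σ * (Real.exp σ + ‖z‖ ^ 2) ^ (-q)) :=
        intervalIntegral.integral_mono_on hαβ (hcontD.abs.intervalIntegrable _ _)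
          ((hcontB.const_mul _).intervalIntegrable _ _) fun σ _ => hpt σ
    _ = C * ‖a‖ * ‖b‖ * ‖w‖ * ∫ σ in α..β, Real.exp σ * (Real.exp σ + ‖z‖ ^ 2) ^ (-q) :=
        intervalIntegral.integral_const_mul _ _
    _ ≤ C * ‖a‖ * ‖b‖ * ‖w‖ * ((‖z‖ ^ 2) ^ (1 - q) / (q - 1)) :=
        mul_le_mul_of_nonneg_left (intervalIntegral_exp_mul_rpow_neg_le hq hc α β) (by positivity)
    _ = (2 * C / (n + 1)) * ‖a‖ * ‖b‖ * ‖z‖ ^ (-(n + 1)) * ‖w‖ := by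
        rw [show 1 - q = -((n + 1) / 2) by rw [hq_def]; ring, norm_sq_rpow_neg_half,
          show q - 1 = (n + 1) / 2 by rw [hq_def]; ring]
        have : (n + 1) ≠ 0 := by linarith
        field_simp

end KernelBounds

/-! ### `P` and `∇P` are integrable -/

section Integrability

variable [MeasurableSpace E] [BorelSpace E]

/-- Tonelli bound for log-time integrals: if `F : ℝ × E → ℝ` is continuous and
`∫ |F(σ, z)| dz ≤ g(σ)` with `g` continuous, then `∫ ‖∫_α^β F(σ, z) dσ‖ dz ≤ ∫_α^β g < ∞`
(`α ≤ β`). [folklore] -/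
theorem lintegral_enorm_intervalIntegral_le {F : ℝ × E → ℝ} (hF : Continuous F) {g : ℝ → ℝ≥0∞}
    (hg : ∀ σ, ∫⁻ z, ‖F (σ, z)‖ₑ ≤ g σ) {α β : ℝ} (hαβ : α ≤ β) :
    ∫⁻ z, ‖∫ σ in α..β, F (σ, z)‖ₑ ≤ ∫⁻ σ in Ioc α β, g σ := by
  have hm : AEMeasurable (uncurry fun (z : E) (σ : ℝ) => ‖F (σ, z)‖ₑ)
      ((volume : Measure E).prod (volume.restrict (Ioc α β))) :=
    (hF.comp (continuous_snd.prodMk continuous_fst)).measurable.enorm.aemeasurable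
  calc ∫⁻ z, ‖∫ σ in α..β, F (σ, z)‖ₑ
      = ∫⁻ z, ‖∫ σ in Ioc α β, F (σ, z)‖ₑ := by simp_rw [intervalIntegral.integral_of_le hαβ]
    _ ≤ ∫⁻ z, ∫⁻ σ in Ioc α β, ‖F (σ, z)‖ₑ := lintegral_mono fun z => enorm_integral_le_lintegral_enorm _
    _ = ∫⁻ σ in Ioc α β, ∫⁻ z, ‖F (σ, z)‖ₑ := lintegral_lintegral_swap hm
    _ ≤ ∫⁻ σ in Ioc α β, g σ := lintegral_mono fun σ => hg σ

omit [FiniteDimensional ℝ E] [MeasurableSpace E] [BorelSpace E] in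
/-- The log-time heat kernel integrand is continuous. [folklore] -/
theorem continuous_logHeat : Continuous (logHeat (E := E)) := contDiff_logHeat.continuous

/-- **`P ∈ L¹`**: `∫ |P| ≤ ∫_α^β e^σ dσ < ∞` (`‖G_s‖₁ = 1`). [folklore] -/
theorem lintegral_enorm_heatPot_lt_top {α β : ℝ} (hαβ : α ≤ β) :
    ∫⁻ z, ‖heatPot (E := E) α β z‖ₑ < ⊤ := by
  have hg : ∀ σ : ℝ, ∫⁻ z : E, ‖logHeat (σ, z)‖ₑ ≤ ENNReal.ofReal (Real.exp σ) := by
    intro σ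
    have h1 : ∀ z : E, ‖logHeat (σ, z)‖ₑ = ENNReal.ofReal (Real.exp σ) * ‖heatKernel (Real.exp σ) z‖ₑ := by
      intro z
      rw [logHeat, enorm_mul, Real.enorm_eq_ofReal (Real.exp_pos σ).le]
    simp_rw [h1]
    rw [lintegral_const_mul' _ _ ENNReal.ofReal_ne_top,
      UnboundedOperators.lintegral_enorm_heatKernel (Real.exp_pos σ), mul_one]
  refine (lintegral_enorm_intervalIntegral_le continuous_logHeat hg hαβ).trans_lt ?_
  calc ∫⁻ σ in Ioc α β, ENNReal.ofReal (Real.exp σ)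
      ≤ ∫⁻ _σ in Ioc α β, ENNReal.ofReal (Real.exp β) := by
        refine setLIntegral_mono measurable_const fun σ hσ => ?_
        exact ENNReal.ofReal_le_ofReal (Real.exp_le_exp.2 hσ.2)
    _ = ENNReal.ofReal (Real.exp β) * volume (Ioc α β) := setLIntegral_const _ _
    _ < ⊤ := ENNReal.mul_lt_top ENNReal.ofReal_lt_top measure_Ioc_lt_top

omit [MeasurableSpace E] [BorelSpace E] in
/-- The derivative of `P` as a time integral of continuous linear maps. [folklore] -/
theorem fderiv_heatPot_eq (α β : ℝ) (z : E) :
    fderiv ℝ (heatPot (E := E) α β) z =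
      ∫ σ in α..β, (fderiv ℝ logHeat (σ, z)).comp (ContinuousLinearMap.inr ℝ ℝ E) :=
  (FunctionSpaces.hasFDerivAt_parametric_intervalIntegral contDiff_logHeat (by simp) α β z).fderiv

omit [FiniteDimensional ℝ E] [MeasurableSpace E] [BorelSpace E] in
/-- The spatial derivative of the log-time integrand: `‖D_z logHeat(σ, ·)(z)‖ = e^σ ‖∇G_{e^σ}(z)‖`.
[folklore] -/
theorem norm_fderiv_logHeat_comp_inr (σ : ℝ) (z : E) :
    ‖(fderiv ℝ (logHeat (E := E)) (σ, z)).comp (ContinuousLinearMap.inr ℝ ℝ E)‖ =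
      Real.exp σ * ‖fderiv ℝ (heatKernel (Real.exp σ)) z‖ := by
  have h : (fderiv ℝ (logHeat (E := E)) (σ, z)).comp (ContinuousLinearMap.inr ℝ ℝ E) =
      fderiv ℝ (fun w => logHeat (σ, w)) z :=
    (FunctionSpaces.hasFDerivAt_comp_prodMk contDiff_logHeat (by simp) σ z).fderiv.symm
  have h2 : fderiv ℝ (fun w => logHeat (E := E) (σ, w)) z =
      Real.exp σ • fderiv ℝ (heatKernel (Real.exp σ)) z := by
    show fderiv ℝ (fun w => Real.exp σ * heatKernel (Real.exp σ) w) z = _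
    rw [fderiv_const_mul ((contDiff_heatKernel_space (n := 1) (Real.exp σ)).differentiable
      one_ne_zero z)]
  rw [h, h2, norm_smul, Real.norm_of_nonneg (Real.exp_pos σ).le]

/-- **`∇P ∈ L¹`**: `∫ ‖∇P‖ ≤ ∫_α^β e^σ ‖∇G_{e^σ}‖₁ dσ < ∞` (`‖∇G_s‖₁ ≤ 2^{n/2} s^{-1/2}`). [folklore] -/
theorem lintegral_enorm_fderiv_heatPot_lt_top {α β : ℝ} (hαβ : α ≤ β) :
    ∫⁻ z, ‖fderiv ℝ (heatPot (E := E) α β) z‖ₑ < ⊤ := by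
  set Φ : ℝ × E → E →L[ℝ] ℝ := fun q =>
    (fderiv ℝ (logHeat (E := E)) q).comp (ContinuousLinearMap.inr ℝ ℝ E) with hΦ
  have hΦc : Continuous Φ :=
    ((ContinuousLinearMap.compL ℝ E (ℝ × E) ℝ).flip (ContinuousLinearMap.inr ℝ ℝ E)).continuous.comp
      (contDiff_logHeat.continuous_fderiv (by simp))
  set g : ℝ → ℝ≥0∞ := fun σ => ENNReal.ofReal (Real.exp σ *
    ((2 : ℝ) ^ ((Module.finrank ℝ E : ℝ) / 2) * (Real.exp σ) ^ (-(1 / 2 : ℝ)))) with hg_def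
  have hg : ∀ σ : ℝ, ∫⁻ z : E, ‖Φ (σ, z)‖ₑ ≤ g σ := by
    intro σ
    have h1 : ∀ z : E, ‖Φ (σ, z)‖ₑ =
        ENNReal.ofReal (Real.exp σ) * ‖fderiv ℝ (heatKernel (Real.exp σ)) z‖ₑ := by
      intro z
      rw [← ofReal_norm, hΦ]
      dsimp only
      rw [norm_fderiv_logHeat_comp_inr, ENNReal.ofReal_mul (Real.exp_pos σ).le, ofReal_norm]
    simp_rw [h1]
    rw [lintegral_const_mul' _ _ ENNReal.ofReal_ne_top]
    change _ ≤ ENNReal.ofReal (Real.exp σ *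
      ((2 : ℝ) ^ ((Module.finrank ℝ E : ℝ) / 2) * (Real.exp σ) ^ (-(1 / 2 : ℝ))))
    rw [ENNReal.ofReal_mul (Real.exp_pos σ).le]
    exact mul_le_mul' le_rfl (UnboundedOperators.lintegral_enorm_fderiv_heatKernel_le (Real.exp_pos σ))
  -- Tonelli for the `E →L[ℝ] ℝ`-valued time integral
  have hm : AEMeasurable (uncurry fun (z : E) (σ : ℝ) => ‖Φ (σ, z)‖ₑ)
      ((volume : Measure E).prod (volume.restrict (Ioc α β))) :=
    (hΦc.comp (continuous_snd.prodMk continuous_fst)).measurable.enorm.aemeasurable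
  have hgc : Continuous fun σ : ℝ => Real.exp σ *
      ((2 : ℝ) ^ ((Module.finrank ℝ E : ℝ) / 2) * (Real.exp σ) ^ (-(1 / 2 : ℝ))) :=
    Real.continuous_exp.mul (continuous_const.mul (Real.continuous_exp.rpow_const
      fun σ => Or.inl (Real.exp_pos σ).ne'))
  obtain ⟨M, hM⟩ := isCompact_Icc.exists_bound_of_continuousOn (hgc.continuousOn (s := Icc α β))
  calc ∫⁻ z, ‖fderiv ℝ (heatPot (E := E) α β) z‖ₑ
      = ∫⁻ z, ‖∫ σ in Ioc α β, Φ (σ, z)‖ₑ := by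
        simp_rw [fderiv_heatPot_eq, intervalIntegral.integral_of_le hαβ]
        rfl
    _ ≤ ∫⁻ z, ∫⁻ σ in Ioc α β, ‖Φ (σ, z)‖ₑ := lintegral_mono fun z => enorm_integral_le_lintegral_enorm _
    _ = ∫⁻ σ in Ioc α β, ∫⁻ z, ‖Φ (σ, z)‖ₑ := lintegral_lintegral_swap hm
    _ ≤ ∫⁻ σ in Ioc α β, g σ := lintegral_mono fun σ => hg σ
    _ ≤ ∫⁻ _σ in Ioc α β, ENNReal.ofReal M := by
        refine setLIntegral_mono measurable_const fun σ hσ => ENNReal.ofReal_le_ofReal ?_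
        exact (le_abs_self _).trans ((Real.norm_eq_abs _).symm.le.trans (hM σ (Ioc_subset_Icc_self hσ)))
    _ = ENNReal.ofReal M * volume (Ioc α β) := setLIntegral_const _ _
    _ < ⊤ := ENNReal.mul_lt_top ENNReal.ofReal_lt_top measure_Ioc_lt_top

end Integrability

end Literature.Analysis.FluidPDE
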